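import Literature.AlgebraicGeometry.Resolution.MarkedIdealsHomogenized
import Literature.AlgebraicGeometry.Resolution.BlowupSequencesExtensions
import Literature.AlgebraicGeometry.Resolution.DerivativeIdealsSupport
import Literature.AlgebraicGeometry.Resolution.RegularLocalRingsQuotient
import Literature.AlgebraicGeometry.Resolution.AlterationsSectionDivisor
import Literature.AlgebraicGeometry.Resolution.MaximalContact
import Literature.AlgebraicGeometry.Resolution.StalkIdealLemmas
import HarnessLib

/-!
# Restriction of the coefficient ideal to a hypersurface of maximal contact (BGMW 2011, Lemma 3.9.4, first claim)

Topic: `Literature/AlgebraicGeometry/Resolution`. Layer of the decomposition of the named facts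
`BierstoneGrigorievMilmanWlodarczyk2011_marked` (`EffectiveResolutionMarked.lean`) and
`BierstoneGrigorievMilmanWlodarczyk2011_canonical` (`CanonicalResolution.lean`; Bierstone–
Grigoriev–Milman–Włodarczyk, arXiv:1206.3090, Thm. 8.0.5). Step 1 of the resolution algorithm
(§4, p. 11) is an induction on dimension: the marked ideal `(𝓘, μ)` of maximal order is replaced
by the restriction `𝒞(𝓘, μ)|_S` of its coefficient ideal (Def. 3.9.2, `MarkedIdeal.coeff`,
`MarkedIdealsHomogenized.lean`) to a hypersurface of maximal contact `S = V(u)` (Step 1b) or to an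
exceptional hypersurface `S = H` (Step 1a), and what makes this work is

  Lemma 3.9.4. "Let `(X, 𝓘, E, μ)` be a marked ideal of maximal order. Assume that `S` has only
  simple normal crossings with `E`. Then `supp(𝓘, μ) ∩ S = supp(𝒞(𝓘, μ)|_S)`."

(followed by the persistence clauses (1)–(3) under multiple blow-ups, not treated in this file).
The printed proof expands `f = Σ c_{α f}(y) x^α` in formal coordinates and refers to [Wlod] for
details. Here the first claim is PROVED for a regular HYPERSURFACE `S = V(H)` — the case in which
it is used in §4 (`S = V(u)` a maximal contact hypersurface, Lemma 3.6.4; `S = H^s_α` an exceptional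
hypersurface, Step 1a) — on a scheme with finitely presented differentials, local coordinates with
dual derivations and regular local rings (e.g. smooth over a perfect field), when `1, …, μ - 1` are
units (characteristic zero, or characteristic `p ≥ μ` as in Thm. 8.0.4), by an elementary argument
with a single derivation which avoids completions:

* `Derivation.mem_pow_of_forall_iterate_mem_sup` — **the algebraic core**: in any commutative
  algebra, if `u ∈ 𝔪`, `δ u = 1`, `1, …, m - 1` are units and `δ^i f ∈ 𝔪^{m-i} + (u)` for all
  `i < m`, then `f ∈ 𝔪^m` (induction on `m`: write `f = h + g u` with `h ∈ 𝔪^m`; Leibniz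
  `δ^{i+1}(g u) = δ^{i+1}(g)·u + (i+1)·δ^i(g)` (`Derivation.iterate_apply_mul_of_apply_eq_one`)
  shows that `g` satisfies the hypothesis at level `m - 1`);
* `Ideal.le_pow_iff_forall_derivIdealIter_le_sup` — ideal form with the derivative ideals `𝒟ⁱ`
  (`derivIdealIter`, `DerivativeIdeals.lean`) and any derivation `δ` with `δ u` a unit:
  **`I ⊆ 𝔪^m ⇔ 𝒟ⁱ(I) ⊆ 𝔪^{m-i} + (u)` for all `i < m`**, i.e. `ord_x 𝓘 ≥ μ ⇔
  ord_x(𝒟ⁱ(𝓘)|_{V(u)}) ≥ μ - i` for all `i` — the printed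
  "`supp(𝓘, μ) ∩ S = ⋂_{f ∈ 𝓘, |α| ≤ μ} supp(c_{α f}|_S, μ - |α|)`", the coefficients
  `c_{α f}|_S = (∂^{|α|} f / α! ∂x^α)|_S` lying in `𝒟^{|α|}(𝓘)|_S`;
  `CoordSystem.exists_isUnit_deriv` — at a point with coordinates, an element `u ∈ 𝔪 ∖ 𝔪²`
  has `∂u/∂u_i` a unit for some coordinate derivation;
* `Ideal.pow_le_pow_mul_sup_span_iff` — `Jᵉ ⊆ 𝔪^{ep} + (u) ⇔ J ⊆ 𝔪ᵖ + (u)` for `u ∈ 𝔪 ∖ 𝔪²`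
  in a regular local ring (the order function of the regular local ring `R/(u)`,
  `RegularLocalOrder.lean`, Matsumura Thm. 14.2), which converts the exponents
  `Π_{j ≠ i}(μ - j)` of `𝒞(𝓘, μ) = (Σ_i (𝒟ⁱ𝓘)^{Π_{j≠i}(μ-j)}, μ!)` back to the marks `μ - i`;
* `MarkedIdeal.mem_support_iff_forall_derivIdealIter_le_sup` — at a point `x` of a scheme with
  `k`-structure: `x ∈ supp(𝓘, μ) ⇔ ∀ i < μ, 𝒟ⁱ(𝓘)_x ⊆ 𝔪_x^{μ-i} + (u)`;
* **`MarkedIdeal.support_coeff_comap_subschemeι`** — Lemma 3.9.4, first claim, for the closed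
  subscheme `S = V(H)` of a hypersurface ideal sheaf `H` which is, at every point of `S`,
  generated by an element of order one: **`supp(𝒞(𝓘, μ)|_S) = ι⁻¹ supp(𝓘, μ)`**, where
  `ι : S → X` is the closed immersion and `𝒞(𝓘, μ)|_S := ι^* 𝒞(𝓘, μ)` (`MarkedIdeal.comap`,
  `BlowupSequencesExtensions.lean`); and the same on a scheme smooth over a perfect field of
  characteristic `p ≥ μ` or `0` (`_of_smooth`).

The hypothesis "`S` has only simple normal crossings with `E`" of the printed lemma concerns the
boundary and plays no role in the support identity; maximal order of `(𝓘, μ)` is not needed for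
it either (it is needed for `S ⊇ supp` to exist, Lemma 3.6.4).

## Sources

* E. Bierstone, D. Grigoriev, P. Milman, J. Włodarczyk, *Effective Hironaka resolution and its
  complexity*, arXiv:1206.3090 (arXiv numbering): Example 3.9.1, Def. 3.9.2, Lemma 3.9.4 and its
  proof (p. 10); §4 Step 1 (p. 11); Thm. 8.0.4 (p. 23). [BierstoneGrigorievMilmanWlodarczyk2011]
* J. Włodarczyk, *Simple Hironaka resolution in characteristic zero*, J. AMS 18 (2005) — "[Wlod]",
  the reference for the details of the printed proof. [Wlodarczyk2005]
* H. Matsumura, *Commutative Ring Theory* (1986), Thm. 14.2 — through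
  `RegularLocalRingsQuotient.lean`. [Matsumura1987]
-/

noncomputable section

open CategoryTheory AlgebraicGeometry TopologicalSpace IsLocalRing

namespace Literature.AlgebraicGeometry.Resolution

universe u v

/-! ## The algebraic core: one derivation transverse to `u` -/

section Ring

variable (R : Type*) {A : Type*} [CommSemiring R] [CommRing A] [Algebra R A]

/-- Iterates of a derivation are additive. [folklore] -/
theorem Derivation.iterate_map_add (δ : Derivation R A A) (n : ℕ) (a b : A) :
    δ^[n] (a + b) = δ^[n] a + δ^[n] b := by
  induction n with
  | zero => rfl
  | succ n ih => rw [Function.iterate_succ_apply', ih, map_add, Function.iterate_succ_apply',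
      Function.iterate_succ_apply']

/-- Iterates of a derivation commute with multiplication by a natural number. [folklore] -/
theorem Derivation.iterate_map_natCast_mul (δ : Derivation R A A) (n : ℕ) (c : ℕ) (a : A) :
    δ^[n] ((c : A) * a) = (c : A) * δ^[n] a := by
  induction n with
  | zero => rfl
  | succ n ih =>
    rw [Function.iterate_succ_apply', ih, Derivation.leibniz, Derivation.map_natCast, smul_zero,
      add_zero, smul_eq_mul, Function.iterate_succ_apply']

/-- **Iterated derivatives of elements of `I` lie in `𝒟ⁱ(I)`.**
[cite: BierstoneGrigorievMilmanWlodarczyk2011, Def. 3.5.1] -/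
theorem Derivation.iterate_apply_mem_derivIdealIter (δ : Derivation R A A) {I : Ideal A} {f : A}
    (hf : f ∈ I) (i : ℕ) : δ^[i] f ∈ derivIdealIter R i I := by
  induction i with
  | zero => simpa using hf
  | succ i ih =>
    rw [Function.iterate_succ_apply', derivIdealIter_succ]
    exact apply_mem_derivIdeal R δ ih

/-- **Iterated derivatives lower the order by at most the number of derivatives**:
`f ∈ Pⁿ ⇒ δ^j f ∈ P^{n-j}`. [cite: BierstoneGrigorievMilmanWlodarczyk2011, Lemma 3.5.2] -/
theorem Derivation.iterate_apply_mem_pow_sub (δ : Derivation R A A) (P : Ideal A) {n : ℕ} {f : A}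
    (hf : f ∈ P ^ n) (j : ℕ) : δ^[j] f ∈ P ^ (n - j) := by
  induction j with
  | zero => simpa using hf
  | succ j ih =>
    rw [Function.iterate_succ_apply', Nat.sub_succ]
    exact Derivation.apply_mem_pow_sub_one R δ P _ ih

/-- **Leibniz against a transverse parameter**: if `δ u = 1` then
`δ^{n+1}(g u) = δ^{n+1}(g) · u + (n + 1) · δ^n(g)`. [folklore] -/
theorem Derivation.iterate_apply_mul_of_apply_eq_one (δ : Derivation R A A) {u : A} (hu : δ u = 1)
    (g : A) : ∀ n : ℕ, δ^[n + 1] (g * u) = δ^[n + 1] g * u + ((n + 1 : ℕ) : A) * δ^[n] g := by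
  intro n
  induction n with
  | zero =>
    simp only [Function.iterate_succ_apply', Function.iterate_zero_apply, Derivation.leibniz, hu,
      smul_eq_mul, mul_one, Nat.cast_one, one_mul, zero_add]
    ring
  | succ n ih =>
    rw [Function.iterate_succ_apply', ih, map_add, Derivation.leibniz, hu, Derivation.leibniz,
      Derivation.map_natCast, smul_zero, add_zero, smul_eq_mul, smul_eq_mul, smul_eq_mul,
      ← Function.iterate_succ_apply' δ (n + 1), ← Function.iterate_succ_apply' δ n]
    push_cast
    ring

/-- **The algebraic core of BGMW Lemma 3.9.4**: let `𝔪` be an ideal, `u ∈ 𝔪`, `δ` a derivation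
with `δ u = 1`, and assume `1, …, m - 1` are units. If `δ^i f ∈ 𝔪^{m-i} + (u)` for every `i < m`
("`ord(δ^i f|_{V(u)}) ≥ m - i`"), then `f ∈ 𝔪^m` ("`ord f ≥ m`"). Induction on `m`: write
`f = h + g u` with `h ∈ 𝔪^m`; by `δ^{i+1}(g u) = δ^{i+1}(g) u + (i+1) δ^i(g)` the element `g`
satisfies the hypothesis at level `m - 1`, so `g ∈ 𝔪^{m-1}` and `f ∈ 𝔪^m`.
[cite: BierstoneGrigorievMilmanWlodarczyk2011, Lemma 3.9.4 (proof)] -/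
theorem Derivation.mem_pow_of_forall_iterate_mem_sup (δ : Derivation R A A) {𝔪 : Ideal A} {u : A}
    (hu : u ∈ 𝔪) (hδu : δ u = 1) :
    ∀ (m : ℕ), (∀ j : ℕ, 0 < j → j < m → IsUnit (j : A)) →
      ∀ {f : A}, (∀ i < m, δ^[i] f ∈ 𝔪 ^ (m - i) ⊔ Ideal.span {u}) → f ∈ 𝔪 ^ m := by
  intro m
  induction m with
  | zero => intro _ f _; simp
  | succ m ih =>
    intro hunit f hf
    -- `f = h + g u` with `h ∈ 𝔪^{m+1}`
    have h0 := hf 0 (Nat.zero_lt_succ m)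
    rw [Function.iterate_zero_apply, Nat.sub_zero] at h0
    obtain ⟨h, hh, w, hw, hfw⟩ := Submodule.mem_sup.mp h0
    obtain ⟨g, rfl⟩ := Ideal.mem_span_singleton'.mp hw
    -- `g ∈ 𝔪^m` by induction
    have hg : g ∈ 𝔪 ^ m := by
      refine ih (fun j hj hjm => hunit j hj (Nat.lt_succ_of_lt hjm)) fun i hi => ?_
      have hf' := hf (i + 1) (Nat.succ_lt_succ hi)
      rw [← hfw, Derivation.iterate_map_add R, Derivation.iterate_apply_mul_of_apply_eq_one R δ hδu,
        Nat.succ_sub_succ] at hf'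
      -- `δ^{i+1} h ∈ 𝔪^{m-i}` and `δ^{i+1}(g) u ∈ (u)`, so `(i+1) δ^i g ∈ 𝔪^{m-i} + (u)`
      have h1 : δ^[i + 1] h ∈ 𝔪 ^ (m - i) ⊔ Ideal.span {u} := by
        refine Ideal.mem_sup_left ?_
        have := Derivation.iterate_apply_mem_pow_sub R δ 𝔪 hh (i + 1)
        rwa [Nat.succ_sub_succ] at this
      have h2 : δ^[i + 1] g * u ∈ 𝔪 ^ (m - i) ⊔ Ideal.span {u} :=
        Ideal.mem_sup_right (Ideal.mul_mem_left _ _ (Ideal.subset_span (Set.mem_singleton u)))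
      have h3 : ((i + 1 : ℕ) : A) * δ^[i] g ∈ 𝔪 ^ (m - i) ⊔ Ideal.span {u} := by
        have := sub_mem (sub_mem hf' h1) h2
        rwa [add_sub_cancel_left, add_sub_cancel_left] at this
      obtain ⟨v, hv⟩ := hunit (i + 1) (Nat.succ_pos i) (Nat.succ_lt_succ hi)
      have : δ^[i] g = (↑v⁻¹ : A) * (((i + 1 : ℕ) : A) * δ^[i] g) := by
        rw [← hv, ← mul_assoc, Units.inv_mul, one_mul]
      rw [this]
      exact Ideal.mul_mem_left _ _ h3
    -- conclude
    rw [← hfw, pow_succ]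
    exact add_mem (by rw [← pow_succ]; exact hh) (Ideal.mul_mem_mul hg hu)

/-- **Ideal form, with the derivative ideals `𝒟ⁱ`**: let `u ∈ 𝔪`, `δ` a derivation with `δ u`
a unit, `1, …, m - 1` units. If `𝒟ⁱ(I) ⊆ 𝔪^{m-i} + (u)` for all `i < m`, then `I ⊆ 𝔪^m`
(rescale `δ` to `(δ u)⁻¹ δ` and use `δ^i f ∈ 𝒟ⁱ(I)`).
[cite: BierstoneGrigorievMilmanWlodarczyk2011, Lemma 3.9.4 (proof)] -/
theorem Ideal.le_pow_of_forall_derivIdealIter_le_sup (δ : Derivation R A A) {𝔪 I : Ideal A}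
    {u : A} (hu : u ∈ 𝔪) (hδu : IsUnit (δ u)) {m : ℕ}
    (hunit : ∀ j : ℕ, 0 < j → j < m → IsUnit (j : A))
    (hI : ∀ i < m, derivIdealIter R i I ≤ 𝔪 ^ (m - i) ⊔ Ideal.span {u}) : I ≤ 𝔪 ^ m := by
  obtain ⟨v, hv⟩ := hδu
  have hδ'u : ((↑v⁻¹ : A) • δ) u = 1 := by
    rw [Derivation.smul_apply, smul_eq_mul, ← hv, Units.inv_mul]
  intro f hf
  exact Derivation.mem_pow_of_forall_iterate_mem_sup R _ hu hδ'u m hunit fun i hi =>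
    hI i hi (Derivation.iterate_apply_mem_derivIdealIter R _ hf i)

/-- **BGMW Lemma 3.9.4, first claim, at a point, for the hypersurface `V(u)`**: with `u ∈ 𝔪`,
a derivation `δ` with `δ u` a unit and `1, …, m - 1` units,
**`I ⊆ 𝔪^m ⇔ 𝒟ⁱ(I) ⊆ 𝔪^{m-i} + (u)` for all `i < m`** — "`x ∈ supp(𝓘, μ) ∩ S` iff
`ord_x(c_α) ≥ μ - |α|` for all `f ∈ 𝓘` and `|α| ≤ μ`", i.e.
`supp(𝓘, μ) ∩ S = ⋂ supp(𝒟^{i}(𝓘)|_S, μ - i)`; the inclusion `⇒` holds in every characteristic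
(`derivIdealIter_le_pow_sub`). [cite: BierstoneGrigorievMilmanWlodarczyk2011, Lemma 3.9.4] -/
theorem Ideal.le_pow_iff_forall_derivIdealIter_le_sup (δ : Derivation R A A) {𝔪 : Ideal A}
    (I : Ideal A) {u : A} (hu : u ∈ 𝔪) (hδu : IsUnit (δ u)) {m : ℕ}
    (hunit : ∀ j : ℕ, 0 < j → j < m → IsUnit (j : A)) :
    I ≤ 𝔪 ^ m ↔ ∀ i < m, derivIdealIter R i I ≤ 𝔪 ^ (m - i) ⊔ Ideal.span {u} :=
  ⟨fun h i _ => (derivIdealIter_le_pow_sub R h i).trans le_sup_left,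
    Ideal.le_pow_of_forall_derivIdealIter_le_sup R δ hu hδu hunit⟩

variable {R}

/-- **An element of order one is transverse to some coordinate derivation**: for a coordinate
system with dual derivations for the maximal ideal `𝔪` of a local algebra and `u ∈ 𝔪 ∖ 𝔪²`,
some `∂u/∂u_i` is a unit (`u ≡ Σ_i (∂u/∂u_i) u_i mod 𝔪²`).
[cite: BierstoneGrigorievMilmanWlodarczyk2011, §3.5] -/
theorem CoordSystem.exists_isUnit_deriv {ι : Type*} [Fintype ι] [IsLocalRing A]
    (c : CoordSystem R (maximalIdeal A) ι) {u : A} (hu : u ∈ maximalIdeal A)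
    (hu2 : u ∉ maximalIdeal A ^ 2) : ∃ i, IsUnit (c.deriv i u) := by
  obtain ⟨i, hi⟩ := c.exists_deriv_not_mem_pow (s := 1) (by rw [Nat.cast_one]; exact isUnit_one)
    (by rwa [pow_one]) hu2
  rw [pow_one] at hi
  exact ⟨i, by simpa [mem_maximalIdeal, mem_nonunits_iff] using hi⟩

/-- With a coordinate system: **`I ⊆ 𝔪^m ⇔ 𝒟ⁱ(I) ⊆ 𝔪^{m-i} + (u)` for all `i < m`**, for
`u ∈ 𝔪 ∖ 𝔪²` in a local algebra with coordinates and dual derivations, `1, …, m - 1` units.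
[cite: BierstoneGrigorievMilmanWlodarczyk2011, Lemma 3.9.4] -/
theorem CoordSystem.le_pow_iff_forall_derivIdealIter_le_sup {ι : Type*} [Fintype ι] [IsLocalRing A]
    (c : CoordSystem R (maximalIdeal A) ι) (I : Ideal A) {u : A} (hu : u ∈ maximalIdeal A)
    (hu2 : u ∉ maximalIdeal A ^ 2) {m : ℕ} (hunit : ∀ j : ℕ, 0 < j → j < m → IsUnit (j : A)) :
    I ≤ maximalIdeal A ^ m ↔
      ∀ i < m, derivIdealIter R i I ≤ maximalIdeal A ^ (m - i) ⊔ Ideal.span {u} := by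
  obtain ⟨i, hi⟩ := c.exists_isUnit_deriv hu hu2
  exact Ideal.le_pow_iff_forall_derivIdealIter_le_sup R (c.deriv i) I hu hi hunit

end Ring

/-! ## Exponents: `Jᵉ ⊆ 𝔪^{ep} + (u) ⇔ J ⊆ 𝔪ᵖ + (u)` in a regular local ring -/

section Regular

variable {A : Type*} [CommRing A]

/-- Pulling back powers of the maximal ideal along a surjection of local rings with kernel `K`:
`q⁻¹(𝔪_Bⁿ) = 𝔪_Aⁿ + K`. [folklore] -/
theorem Ideal.comap_maximalIdeal_pow_of_surjective {B : Type*} [CommRing B] [IsLocalRing A]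
    [IsLocalRing B] (q : A →+* B) (hq : Function.Surjective q) (n : ℕ) :
    (maximalIdeal B ^ n).comap q = maximalIdeal A ^ n ⊔ RingHom.ker q := by
  rw [← map_maximalIdeal_of_surjective q hq, ← Ideal.map_pow, Ideal.comap_map_of_surjective q hq,
    RingHom.ker_eq_comap_bot]

/-- Along a surjection of local rings with kernel `K`: `J·B ⊆ 𝔪_Bⁿ ⇔ J ⊆ 𝔪_Aⁿ + K`. [folklore] -/
theorem Ideal.map_le_maximalIdeal_pow_iff_of_surjective {B : Type*} [CommRing B] [IsLocalRing A]
    [IsLocalRing B] (q : A →+* B) (hq : Function.Surjective q) (J : Ideal A) (n : ℕ) :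
    J.map q ≤ maximalIdeal B ^ n ↔ J ≤ maximalIdeal A ^ n ⊔ RingHom.ker q := by
  rw [Ideal.map_le_iff_le_comap, Ideal.comap_maximalIdeal_pow_of_surjective q hq]

/-- **`Jᵉ ⊆ 𝔪^{ep} + (u) ⇔ J ⊆ 𝔪ᵖ + (u)`** (`e ≥ 1`) for `u ∈ 𝔪 ∖ 𝔪²` in a regular local ring:
the order function of the regular local ring `A/(u)` (Matsumura Thm. 14.2;
`Ideal.pow_le_pow_mul_iff`, `RegularLocalOrder.lean`). [cite: Matsumura1987, Thm. 14.2] -/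
theorem Ideal.pow_le_pow_mul_sup_span_iff [IsRegularLocalRing A] {u : A} (hu : u ∈ maximalIdeal A)
    (hu2 : u ∉ maximalIdeal A ^ 2) (J : Ideal A) {e p : ℕ} (he : 0 < e) :
    J ^ e ≤ maximalIdeal A ^ (e * p) ⊔ Ideal.span {u} ↔ J ≤ maximalIdeal A ^ p ⊔ Ideal.span {u} := by
  haveI := isLocalRing_quotient (Ideal.span_singleton_ne_top hu)
  haveI := (IsRegularLocalRing.quotient_span_singleton hu hu2).1
  have hq : Function.Surjective (Ideal.Quotient.mk (Ideal.span {u})) := Ideal.Quotient.mk_surjective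
  have hker : RingHom.ker (Ideal.Quotient.mk (Ideal.span {u})) = Ideal.span {u} := Ideal.mk_ker
  rw [← hker, ← Ideal.map_le_maximalIdeal_pow_iff_of_surjective _ hq,
    ← Ideal.map_le_maximalIdeal_pow_iff_of_surjective _ hq, Ideal.map_pow,
    Ideal.pow_le_pow_mul_iff he]

end Regular

/-! ## At a point of a scheme with `k`-structure -/

section Scheme

variable {k : Type v} [CommRing k] {X : Scheme.{u}} {φ : k →+* Γ(X, ⊤)}

/-- **BGMW Lemma 3.9.4, first claim, at a point**: on a scheme with finitely presented
differentials and local coordinates with dual derivations, for a marked ideal `(X, 𝓘, E, μ)` with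
`1, …, μ - 1` units in `𝒪_{X,x}` and an element `u ∈ 𝔪_x ∖ 𝔪_x²`:
**`x ∈ supp(𝓘, μ) ⇔ 𝒟ⁱ(𝓘)_x ⊆ 𝔪_x^{μ-i} + (u)` for all `i < μ`** (`supp(𝓘, μ) ∩ V(u) =
⋂_i supp(𝒟ⁱ(𝓘)|_{V(u)}, μ - i)` near `x`). [cite: BierstoneGrigorievMilmanWlodarczyk2011, Lemma 3.9.4] -/
theorem MarkedIdeal.mem_support_iff_forall_stalkIdeal_derivIdealSheafIter_le_sup
    (hX : HasFinitePresentationDifferentials φ) (hc : HasLocalCoordinates φ) (M : MarkedIdeal X)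
    {x : X} (hunit : ∀ j : ℕ, 0 < j → j < M.mult → IsUnit (j : X.presheaf.stalk x))
    {u : X.presheaf.stalk x} (hu : u ∈ maximalIdeal (X.presheaf.stalk x))
    (hu2 : u ∉ maximalIdeal (X.presheaf.stalk x) ^ 2) :
    x ∈ M.support ↔ ∀ i < M.mult, stalkIdeal (derivIdealSheafIter φ i M.ideal) x ≤
      maximalIdeal (X.presheaf.stalk x) ^ (M.mult - i) ⊔ Ideal.span {u} := by
  rw [MarkedIdeal.mem_support_iff]
  letI := stalkAlgebra φ x
  obtain ⟨c⟩ := hc x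
  rw [c.le_pow_iff_forall_derivIdealIter_le_sup (stalkIdeal M.ideal x) hu hu2 hunit]
  refine forall₂_congr fun i _ => ?_
  rw [stalkIdeal_derivIdealSheafIter hX]

/-! ## Restriction to the hypersurface `S = V(H)` -/

variable (H : X.IdealSheafData)

/-- **The kernel of `𝒪_{X, ι s} → 𝒪_{S, s}` for the closed subscheme `ι : S = V(H) → X` is the
stalk `H_{ι s}`** (`stalkIdeal_ker_eq_ker_stalkMap` with `ker ι = H`). [folklore] -/
theorem ker_stalkMap_subschemeι (s : H.subscheme) :
    RingHom.ker (H.subschemeι.stalkMap s).hom = stalkIdeal H (H.subschemeι s) := by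
  rw [← stalkIdeal_ker_eq_ker_stalkMap H.subschemeι s, Scheme.IdealSheafData.ker_subschemeι]

/-- The points of `S = V(H)` map into `V(H)`. [folklore] -/
theorem subschemeι_apply_mem_support (s : H.subscheme) : H.subschemeι s ∈ H.support := by
  change H.subschemeι s ∈ (H.support : Set X)
  rw [← Scheme.IdealSheafData.range_subschemeι]
  exact ⟨s, rfl⟩

variable {H}

/-- A generator of the stalk `H_{ι s}` lies in the maximal ideal (the kernel of a homomorphism to
the nonzero ring `𝒪_{S,s}` is proper). [folklore] -/
theorem mem_maximalIdeal_of_stalkIdeal_eq_span (s : H.subscheme) {u : X.presheaf.stalk (H.subschemeι s)}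
    (hHu : stalkIdeal H (H.subschemeι s) = Ideal.span {u}) :
    u ∈ maximalIdeal (X.presheaf.stalk (H.subschemeι s)) := by
  have hne : Ideal.span {u} ≠ ⊤ := by
    rw [← hHu, ← ker_stalkMap_subschemeι H s]
    exact RingHom.ker_ne_top _
  rw [mem_maximalIdeal, mem_nonunits_iff]
  exact fun h => hne (Ideal.span_singleton_eq_top.mpr h)

/-- **One term of `𝒞(𝓘, μ)|_S` at a point**: for `ι : S = V(H) → X`, `s ∈ S`, `x = ι s` with
`𝒪_{X,x}` regular and `H_x = (u)`, `u ∉ 𝔪_x²`, an ideal `J ⊆ 𝒪_{X,x}` and `e ≥ 1`: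
`Jᵉ · 𝒪_{S,s} ⊆ 𝔪_s^{e p} ⇔ J ⊆ 𝔪_xᵖ + (u)`. [cite: BierstoneGrigorievMilmanWlodarczyk2011, Lemma 3.9.4 (proof)] -/
theorem map_stalkMap_subschemeι_pow_le_iff (s : H.subscheme)
    [IsRegularLocalRing (X.presheaf.stalk (H.subschemeι s))]
    {u : X.presheaf.stalk (H.subschemeι s)} (hHu : stalkIdeal H (H.subschemeι s) = Ideal.span {u})
    (hu2 : u ∉ maximalIdeal (X.presheaf.stalk (H.subschemeι s)) ^ 2)
    (J : Ideal (X.presheaf.stalk (H.subschemeι s))) {e p : ℕ} (he : 0 < e) :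
    (J ^ e).map (H.subschemeι.stalkMap s).hom ≤ maximalIdeal (H.subscheme.presheaf.stalk s) ^ (e * p) ↔
      J ≤ maximalIdeal (X.presheaf.stalk (H.subschemeι s)) ^ p ⊔ Ideal.span {u} := by
  have hq : Function.Surjective (H.subschemeι.stalkMap s).hom := H.subschemeι.stalkMap_surjective s
  rw [Ideal.map_le_maximalIdeal_pow_iff_of_surjective _ hq, ker_stalkMap_subschemeι H s, hHu]
  exact Ideal.pow_le_pow_mul_sup_span_iff (mem_maximalIdeal_of_stalkIdeal_eq_span s hHu) hu2 J he

/-- **BGMW Lemma 3.9.4, first claim, for a regular hypersurface `S = V(H)`**: let `X` be a scheme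
with `k`-structure having finitely presented differentials and local coordinates with dual
derivations (e.g. smooth over a perfect field), `(X, 𝓘, E, μ)` a marked ideal with `1, …, μ - 1`
units in the local rings, and `H` an ideal sheaf which at every point `x ∈ V(H)` has regular
ambient local ring `𝒪_{X,x}` and stalk `H_x = (u)` generated by an element of order one (so
`S = V(H)` is a regular hypersurface; e.g. a maximal contact hypersurface, Lemma 3.6.4, or an
exceptional hypersurface). Then for the closed immersion `ι : S → X` and the restricted
coefficient ideal `𝒞(𝓘, μ)|_S := ι^*𝒞(𝓘, μ) = (S, 𝒞(𝓘)·𝒪_S, E|_S, μ!)`: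
**`supp(𝒞(𝓘, μ)|_S) = ι⁻¹(supp(𝓘, μ))`**, i.e. `supp(𝓘, μ) ∩ S = supp(𝒞(𝓘, μ)|_S)`.
[cite: BierstoneGrigorievMilmanWlodarczyk2011, Lemma 3.9.4] -/
theorem MarkedIdeal.support_coeff_comap_subschemeι (hX : HasFinitePresentationDifferentials φ)
    (hc : HasLocalCoordinates φ) (M : MarkedIdeal X)
    (hunit : ∀ (x : X) (j : ℕ), 0 < j → j < M.mult → IsUnit (j : X.presheaf.stalk x))
    (hreg : ∀ x ∈ H.support, IsRegularLocalRing (X.presheaf.stalk x))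
    (hH : ∀ x ∈ H.support, ∃ u : X.presheaf.stalk x,
      stalkIdeal H x = Ideal.span {u} ∧ u ∉ maximalIdeal (X.presheaf.stalk x) ^ 2) :
    ((M.coeff φ).comap H.subschemeι).support = H.subschemeι ⁻¹' M.support := by
  ext s
  have hxH := subschemeι_apply_mem_support H s
  obtain ⟨u, hHu, hu2⟩ := hH _ hxH
  haveI := hreg _ hxH
  have hu := mem_maximalIdeal_of_stalkIdeal_eq_span s hHu
  rw [Set.mem_preimage, M.mem_support_iff_forall_stalkIdeal_derivIdealSheafIter_le_sup hX hc
    (hunit _) hu hu2, MarkedIdeal.mem_support_iff, MarkedIdeal.comap_ideal, MarkedIdeal.comap_mult,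
    stalkIdeal_comap_eq_map_stalkMap, stalkIdeal_coeff hX, MarkedIdeal.coeff_mult_eq_prod, Ideal.map_iSup,
    iSup_le_iff, Fin.forall_iff]
  refine forall₂_congr fun i hi => ?_
  letI := stalkAlgebra φ (H.subschemeι s)
  have he : 0 < ∏ j ∈ Finset.univ.erase (⟨i, hi⟩ : Fin M.mult), (M.mult - (j : ℕ)) :=
    Finset.prod_pos fun j _ => by
      have := j.2
      omega
  rw [← M.sub_mul_prod_erase ⟨i, hi⟩, mul_comm, map_stalkMap_subschemeι_pow_le_iff s hHu hu2 _ he,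
    stalkIdeal_derivIdealSheafIter hX]

end Scheme

/-! ## On a scheme smooth over a perfect field -/

section Smooth

variable (k : Type u) [Field k] (X : Scheme.{u}) [X.Over (Spec (.of k))]

/-- **BGMW Lemma 3.9.4, first claim, on a scheme smooth over a perfect field of characteristic
`p`** (or `0`): for a marked ideal `(X, 𝓘, E, μ)` with `μ ≤ p` and an ideal sheaf `H` whose stalk
at every point of `V(H)` is generated by an element of order one (a regular hypersurface
`S = V(H)`, `ι : S → X`): `supp(𝒞(𝓘, μ)|_S) = ι⁻¹(supp(𝓘, μ))`.
[cite: BierstoneGrigorievMilmanWlodarczyk2011, Lemma 3.9.4 with Thm. 8.0.4] -/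
theorem MarkedIdeal.support_coeff_comap_subschemeι_of_smooth (p : ℕ) [CharP k p] [PerfectField k]
    [Smooth (X ↘ Spec (.of k))] (M : MarkedIdeal X) (hμ : p = 0 ∨ M.mult ≤ p)
    {H : X.IdealSheafData} (hH : ∀ x ∈ H.support, ∃ u : X.presheaf.stalk x,
      stalkIdeal H x = Ideal.span {u} ∧ u ∉ maximalIdeal (X.presheaf.stalk x) ^ 2) :
    ((M.coeff (overHom k X)).comap H.subschemeι).support = H.subschemeι ⁻¹' M.support :=
  M.support_coeff_comap_subschemeι (hasFinitePresentationDifferentials_overHom k X)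
    (hasLocalCoordinates_overHom k X)
    (fun x j hj hjμ => isUnit_natCast_stalk_overHom k X p x hj (hμ.imp id fun h => by omega))
    (fun x _ => Scheme.isRegular_of_smooth_over_field k X x) hH

end Smooth

end Literature.AlgebraicGeometry.Resolution

end
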